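import Literature.NumberTheory.EllipticCurves.FormalGroupLogSummableProofs
import Literature.NumberTheory.EllipticCurves.FormalGroupDenominators
import HarnessLib

/-!
# The formal exponential of a Weierstrass curve converges for `v(z) > 1/(p - 1)`
# (Silverman AEC IV.6.4(b)): discharge of the named fact `WeierstrassCurve.summable_formalExp`
# (proofs only)

Trunk T-NT-EC (Literature/NumberTheory/EllipticCurves). No new definitions; every declaration is
a theorem about the objects of `FormalGroup.lean` (`formalLog = ∫ω`, `formalExp = formalLog⁻¹`),
stated as dot-notation extensions in Mathlib's `WeierstrassCurve` namespace like the sibling proof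
files (`FormalGroupLogSummableProofs.lean`, whose `isPadicInt_formalOmega` — AEC IV.1,
`ω ∈ ℤ[a₁, …, a₆]⟦z⟧` — is the integrality input here too).

## The printed argument and its formalisation

Silverman, *AEC* IV.6.4(b): for a formal group over the valuation ring `R` of a complete field of
characteristic `0` and an integer `r > v(p)/(p - 1)`, `exp` converges on `𝓜ʳ`, because
(IV.5.5) `exp(T) = Σ (bₙ/n!) Tⁿ` with `bₙ ∈ R` — itself from `log(T) = Σ (aₙ/n) Tⁿ`, `aₙ ∈ R`,
and the inversion lemma IV.5.4 — and (IV.6.2, IV.6.3(b)) `v(bₙxⁿ/n!) ≥ n v(x) - v(n!) ≥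
n v(x) - (n - 1)v(p)/(p - 1) → ∞`. For `W/ℚ_p` with `p`-integral coefficients (`v(p) = 1`):

* `norm_factorial_mul_coeff_formalLog_le_one` — **IV.5.5, `log` half, in factorial form**:
  `n! · coeff n log_W ∈ ℤ_p` (`(n+2)! · coeff (n+2) log_W = (n+1)! · cₙ₊₁` with `cₙ₊₁ ∈ ℤ_p` a
  coefficient of `ω`, `isPadicInt_formalOmega`);
* `norm_factorial_mul_coeff_formalExp_le_one` — **IV.5.5, `exp` half**: `n! · coeff n exp_W ∈ ℤ_p`,
  by AEC IV.5.4 (`Literature.NumberTheory.EllipticCurves.factorial_mul_coeff_mem_of_subst_eq_X`,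
  `FormalGroupDenominators.lean`) applied to `log_W ∘ exp_W = X` with `S = ℤ_p ⊂ ℚ_p` and
  `a₁ = coeff 1 log_W = 1`;
* `summable_formalExp_of_isIntegral` and **`summable_formalExp_holds : summable_formalExp`** —
  AEC IV.6.4(b) for `Ê`: `Σ (coeff n exp_W) tⁿ` is summable for `‖t‖_p < p^{-1/(p-1)}`, by
  IV.6.2 + IV.6.3(b) (`Literature.NumberTheory.EllipticCurves.padic_summable_of_norm_factorial_mul_le`).

## Sources

* J. H. Silverman, *The Arithmetic of Elliptic Curves*, 2nd ed., GTM 106 (2009): Lemma IV.5.4 and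
  Prop. IV.5.5 (§IV.5, pp. 127–129), Lemma IV.6.2, Lemma IV.6.3(b), Thm. IV.6.4(b) (§IV.6,
  pp. 129–132) (`SilvermanAEC2009`).
-/

noncomputable section

open PowerSeries Nat Literature.NumberTheory.EllipticCurves

namespace WeierstrassCurve

section Padic

variable {p : ℕ} [Fact p.Prime] (W : WeierstrassCurve ℚ_[p]) [hW : W.IsIntegral ℤ_[p]]

/-- **AEC IV.5.5 for `Ê`, logarithm, factorial form**: for a `p`-integral `W/ℚ_p`,
`‖n! · coeff n log_W‖_p ≤ 1`, i.e. `log_W = Σ (aₙ/n!) zⁿ` with `aₙ ∈ ℤ_p` (indeed `aₙ = (n-1)! cₙ₋₁`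
with `cₙ₋₁ ∈ ℤ_p` the coefficients of `ω`, AEC IV.1). [Silverman AEC IV.5.5]
[cite: SilvermanAEC2009, IV.5.5] -/
theorem norm_factorial_mul_coeff_formalLog_le_one (n : ℕ) :
    ‖((n ! : ℕ) : ℚ_[p]) * coeff n W.formalLog‖ ≤ 1 := by
  rcases n with _ | _ | n
  · simp [formalLog, coeff_mk]
  · simp [formalLog, coeff_mk]
  · rw [formalLog, coeff_mk]
    dsimp only
    have h2 : ‖coeff (n + 1) W.formalOmega‖ ≤ 1 := isPadicInt_iff_coeff.mp W.isPadicInt_formalOmega _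
    have hn : ((n + 2 : ℕ) : ℚ_[p]) ≠ 0 := Nat.cast_ne_zero.mpr (Nat.succ_ne_zero _)
    have e : (((n + 2)! : ℕ) : ℚ_[p]) *
        (algebraMap ℚ ℚ_[p] (1 / (n + 2 : ℚ)) * coeff (n + 1) W.formalOmega) =
          (((n + 1)! : ℕ) : ℚ_[p]) * coeff (n + 1) W.formalOmega := by
      rw [map_div₀, map_one, show algebraMap ℚ ℚ_[p] (n + 2 : ℚ) = ((n + 2 : ℕ) : ℚ_[p]) by
        rw [map_add, map_natCast, map_ofNat]; push_cast; ring, Nat.factorial_succ (n + 1),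
        Nat.cast_mul]
      field_simp
    rw [e, norm_mul]
    have h1 : ‖(((n + 1)! : ℕ) : ℚ_[p])‖ ≤ 1 := by
      simpa using Padic.norm_int_le_one (p := p) ((n + 1)! : ℤ)
    calc _ ≤ (1 : ℝ) * 1 := mul_le_mul h1 h2 (norm_nonneg _) zero_le_one
      _ = 1 := one_mul _

/-- **AEC IV.5.5 for `Ê`, exponential**: for a `p`-integral `W/ℚ_p`, `‖n! · coeff n exp_W‖_p ≤ 1`,
i.e. `exp_W = Σ (bₙ/n!) zⁿ` with `bₙ ∈ ℤ_p` — AEC IV.5.4 applied to `log_W(exp_W(z)) = z` with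
`a₁ = 1`. [Silverman AEC IV.5.5 (with IV.5.4)] [cite: SilvermanAEC2009, IV.5.5] -/
theorem norm_factorial_mul_coeff_formalExp_le_one (n : ℕ) :
    ‖((n ! : ℕ) : ℚ_[p]) * coeff n W.formalExp‖ ≤ 1 := by
  rw [← PadicInt.mem_subring_iff]
  refine factorial_mul_coeff_mem_of_subst_eq_X (PadicInt.subring p) (f := W.formalLog)
    (fun m => ?_) (u := 1) (one_mem _) (by rw [coeff_one_formalLog, one_mul])
    W.constantCoeff_formalExp W.formalLog_subst_formalExp n
  rw [PadicInt.mem_subring_iff]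
  exact W.norm_factorial_mul_coeff_formalLog_le_one m

/-- **AEC IV.6.4(b) for `Ê` (instance form)**: for a `p`-integral `W/ℚ_p` and
`‖t‖_p < p^{-1/(p-1)}` (i.e. `v(t) > v(p)/(p - 1)`), the series `Σ (coeff n exp_W) tⁿ` is
summable (IV.5.5: `n! · coeff n exp_W ∈ ℤ_p`; IV.6.2/6.3(b): `‖coeff n exp_W · tⁿ‖ ≤
(p^{1/(p-1)}‖t‖)ⁿ`). [Silverman AEC IV.6.4(b), IV.6.3(b)] [cite: SilvermanAEC2009, IV.6.4] -/
theorem summable_formalExp_of_isIntegral (t : ℚ_[p])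
    (ht : ‖t‖ < (p : ℝ) ^ (-(1 / ((p : ℝ) - 1)))) :
    Summable fun n : ℕ => coeff n W.formalExp * t ^ n :=
  padic_summable_of_norm_factorial_mul_le W.norm_factorial_mul_coeff_formalExp_le_one ht

end Padic

/-- **Discharge of the named fact `summable_formalExp` (Silverman AEC IV.6.4(b) for the formal
group of a `p`-integral Weierstrass curve over `ℚ_p`)**: `exp_W` converges for
`v_p(z) > 1/(p - 1)`. [Silverman AEC IV.6.4(b)] [cite: SilvermanAEC2009, IV.6.4] -/
theorem summable_formalExp_holds : summable_formalExp :=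
  fun _ _ W _ t ht => W.summable_formalExp_of_isIntegral t ht

end WeierstrassCurve
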